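import Summits.KontsevichZagierPeriods.KontsevichZagierPeriods.Theses.FermatIsogeny
import Summits.KontsevichZagierPeriods.KontsevichZagierPeriods.Theorems.TerasomaMultiplicationBetaCancellationEulerFinal

/-!
# Reflection at `1/9` inside the Kontsevich–Zagier calculus (item stmt-KontsevichZagierPeriods-3900)

`ReflectionNinth` of route FermatIsogeny: the one-dimensional representation
`[(0,1), sin(π/9)·x^{-8/9}(1-x)^{-1/9}]` is equivalent, by the moves of the Kontsevich–Zagier
calculus, to the closed unit disc with integrand `1` (`sin(π/9)·B(1/9,8/9) = π`). It is literally
the instance `a = 1/9` of `CompiledSubstitutions.EulerReflectionRational`, proved in the tree as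
`BetaCancellationLine.stub_eulerReflection`; only the casts `((1/9 : ℚ) : ℝ) - 1 = -8/9`,
`-((1/9 : ℚ) : ℝ) = -1/9`, `π·(1/9) = π/9` separate the two signatures.
-/

noncomputable section

-- `Summit.KontsevichZagierPeriods.KontsevichZagierPeriods.…` is the tree's mandated layout (single-conjunct summit).
set_option linter.dupNamespace false

namespace Summit.KontsevichZagierPeriods.KontsevichZagierPeriods.Theorems

open Summit.KontsevichZagierPeriods.KontsevichZagierPeriods.Theses.FermatIsogeny (ReflectionNinth)
open Summit.KontsevichZagierPeriods.KontsevichZagierPeriods.BetaCancellationLine (stub_eulerReflection)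

/-- **Reflection at `1/9`** (item stmt-KontsevichZagierPeriods-3900, route FermatIsogeny):
`[(0,1), sin(π/9)·x^{-8/9}(1-x)^{-1/9}] ∼ [closed unit disc, 1]` in the Kontsevich–Zagier calculus,
i.e. `sin(π/9)·B(1/9,8/9) = π` by the moves — the instance `a = 1/9` of Euler's reflection formula
inside the calculus (`BetaCancellationLine.stub_eulerReflection`). [folklore] -/
theorem reflectionNinth_proof : ReflectionNinth := by
  intro r p hr hri hp hpi
  refine stub_eulerReflection (1 / 9) (by norm_num) (by norm_num) r p hr ?_ hp hpi
  intro x hx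
  have e1 : Real.pi * ((1 / 9 : ℚ) : ℝ) = Real.pi / 9 := by push_cast; ring
  have e2 : ((1 / 9 : ℚ) : ℝ) - 1 = -(8:ℝ) / 9 := by push_cast; ring
  have e3 : -((1 / 9 : ℚ) : ℝ) = -(1:ℝ) / 9 := by push_cast; ring
  rw [e1, e2, e3]
  exact hri hx

end Summit.KontsevichZagierPeriods.KontsevichZagierPeriods.Theorems
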